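/-
Origin: expansion seat `planner-pub-hodgecm-pv05-g7-0`, handover #9 v2 2026-08-18T15:10:14Z md5 6137b643c1df4e54984decb693725047 SUPERSEDES de790f3f561c5f78efb90209090dc470 (`HOME/pub-hodgecm-pv05-g7/lean/Pv05g7/FockStoneClosure.lean`, md5 6137b643, 221 lines);
landed by the gen-8 packager in gate run 31 as `HodgeCM/PerL34/FockStoneClosure.lean` (import ^import Pv05g7\.FockStoneGenerator[ \t]*$→import HodgeCM.PerL34.FockStoneGenerator ×1).
-/
/-
Origin: expansion seat `planner-pub-hodgecm-pv05-g7-0` (unit pub-hodgecm-pv05-g7, DAG-NODE PROVER #05 gen 7), leaf #9.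
Handover import: `Pv05g7.FockStoneGenerator` ↦ `HodgeCM.PerL34.FockStoneGenerator` (pv05-g7 #8).

# The Stone generator is the closure of `dΓ(X)|_{core}` and is skew-adjoint (`X ∈ 𝔲(σ)`)

KERNEL, additive leaf of the pv05 Fock lane (namespace `HodgeCM.PerL34.Fock.Hermite`).  Mathlib + lane only; no
citation is used as a hypothesis; hypotheses are `[Fintype σ] [DecidableEq σ]` and the displayed `star X = -X`.

Leaf #8 constructed the generator `genOp hX : genDom hX →ₗ[ℂ] 𝓕_σ` of `t ↦ ν₀(e^{tX})` on its maximal domain and showed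
that it extends `dΓ(X)` on the polynomial core.  This file proves, in concrete Hilbert-space terms (the restatement in
Mathlib's `LinearPMap` vocabulary — `LinearPMap.adjoint`, `LinearPMap.IsClosed`, `IsSelfAdjoint` — and in the package's
vendored `Literature.Analysis.UnboundedOperators` `generator`/`hamiltonian` language is the separate leaf
`FockStoneHamiltonian`), the four statements that together say
**"`dΓ(X)|_{core}` is essentially skew-adjoint and its closure is the Stone generator"**:

1. (§1) the spectral basis consists of CORE vectors that are eigenvectors of `dΓ(X)`: `specZeta hX m` with
   `fockToL2 (specZeta hX m) = specBasis hX m` and `dΓ(X)(specZeta m) = i⟨m,λ⟩ · specZeta m`.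
2. (§2) **adjoint**: for `u, w ∈ 𝓕_σ`, `(∀ F, ⟪(dΓ(X)F)~, u⟫ + ⟪F~, w⟫ = 0) ↔ (u ∈ genDom ∧ genOp u = w)`
   (`mem_genDom_of_forall_inner_core`, `genOp_eq_of_forall_inner_core`, converse `inner_dGamma_add_inner_genOp`):
   the adjoint of `dΓ(X)|_{core}` is `−genOp`; in particular (§2) `genOp` is SKEW-ADJOINT
   (`mem_genDom_of_forall_inner_genDom`: testing against `genDom` instead of the core gives the same domain).
3. (§3) **closed**: if `v_n → x` and `genOp v_n → y` along any non-trivial filter then `x ∈ genDom` and `genOp x = y`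
   (`mem_genDom_of_tendsto`, `genOp_eq_of_tendsto`).
4. (§4) **the core is a core**: for `v ∈ genDom` the spectral truncations `F_s := Σ_{m ∈ s} v_m · specZeta m`
   (`specTrunc`) satisfy `(F_s)~ → v` and `(dΓ(X) F_s)~ → genOp v` along `s → ∞` in `Finset (σ →₀ ℕ)`
   (`tendsto_fockToL2_specTrunc`, `tendsto_fockToL2_dGamma_specTrunc`): the graph of `genOp` is the closure of the
   graph of `dΓ(X)|_{core}`.

HONEST LABEL.  Compact directions `X ∈ 𝔲(σ)` only; all statements are about the concrete operator `genOp hX` of #8 and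
the concrete core `fockToL2 (MvPolynomial σ ℂ)`; nothing is asserted about non-compact/metaplectic directions, and no
PerL/QW8 claim is touched.
-/
import Summits.HodgeConjecture.HodgeCM.PerL34.FockStoneGenerator

noncomputable section

namespace HodgeCM.PerL34.Fock.Hermite

open Complex MvPolynomial Matrix NormedSpace Filter Topology
open scoped Real Nat ComplexConjugate InnerProductSpace ENNReal

/- All inner products below are the Hilbert-space ones of `FockL2 σ` (see the note in `FockLadderAdjoint`). -/
attribute [local instance 10000] InnerProductSpace.toInner

variable {σ : Type*} [Fintype σ] [DecidableEq σ]

/-! ## §1  The spectral basis consists of core eigenvectors of `dΓ(X)` -/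

/-- The core polynomial `ζ_m ∘ Vᴴ` whose `L²`-class is the `m`-th spectral basis vector. -/
def specZeta {X : Matrix σ σ ℂ} (hX : star X = -X) (m : σ →₀ ℕ) : MvPolynomial σ ℂ :=
  linSubst (star (specU hX : Matrix σ σ ℂ)) (zeta m)

/-- (Ported verbatim from the HodgeCMPerL package; no docstring in the source.) -/
theorem specZeta_eq_smul {X : Matrix σ σ ℂ} (hX : star X = -X) (m : σ →₀ ℕ) :
    specZeta hX m = (hcoef m : ℂ) • linSubst (star (specU hX : Matrix σ σ ℂ)) (monomial m 1) := by
  rw [specZeta, zeta, map_smul]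

/-- `(specZeta m)~ = specBasis m`: every spectral basis vector is a core vector. -/
theorem fockToL2_specZeta {X : Matrix σ σ ℂ} (hX : star X = -X) (m : σ →₀ ℕ) :
    fockToL2 (specZeta hX m) = specBasis hX m := by
  rw [specZeta, ← fockRep_specU_fockToL2, fockToL2_zeta, ← fockBasis_apply, specBasis_apply]

/-- `dΓ(X) (specZeta m) = i⟨m,λ⟩ · specZeta m`. -/
theorem dGamma_specZeta {X : Matrix σ σ ℂ} (hX : star X = -X) (m : σ →₀ ℕ) :
    dGamma X (specZeta hX m) = (I * (wtPair m (specFreq hX) : ℂ)) • specZeta hX m := by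
  rw [specZeta_eq_smul, map_smul, dGamma_specPoly, smul_comm]

/-- (Ported verbatim from the HodgeCMPerL package; no docstring in the source.) -/
theorem fockToL2_dGamma_specZeta {X : Matrix σ σ ℂ} (hX : star X = -X) (m : σ →₀ ℕ) :
    fockToL2 (dGamma X (specZeta hX m)) = (I * (wtPair m (specFreq hX) : ℂ)) • specBasis hX m := by
  rw [dGamma_specZeta, map_smul, fockToL2_specZeta]

/-! ## §2  The adjoint of `dΓ(X)|_{core}` is `−genOp`; `genOp` is skew-adjoint -/

/-- Easy direction: for `u ∈ genDom`, `⟪(dΓ(X)F)~, u⟫ + ⟪F~, genOp u⟫ = 0` for every core vector. -/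
theorem inner_dGamma_add_inner_genOp {X : Matrix σ σ ℂ} (hX : star X = -X) (F : MvPolynomial σ ℂ)
    (u : genDom hX) :
    ⟪fockToL2 (dGamma X F), (u : FockL2 σ)⟫_ℂ + ⟪fockToL2 F, genOp hX u⟫_ℂ = 0 := by
  have h := inner_genOp_add_inner_genOp hX ⟨fockToL2 F, fockToL2_mem_genDom hX F⟩ u
  rwa [genOp_fockToL2] at h

/-- The coordinate identity behind the adjoint computation: testing against `specZeta m` gives
`w_m = i⟨m,λ⟩ u_m`. -/
theorem specBasis_repr_eq_of_forall_inner_core {X : Matrix σ σ ℂ} (hX : star X = -X) {u w : FockL2 σ}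
    (h : ∀ F : MvPolynomial σ ℂ, ⟪fockToL2 (dGamma X F), u⟫_ℂ + ⟪fockToL2 F, w⟫_ℂ = 0) (m : σ →₀ ℕ) :
    (specBasis hX).repr w m = I * (wtPair m (specFreq hX) : ℂ) * (specBasis hX).repr u m := by
  have hm := h (specZeta hX m)
  rw [fockToL2_dGamma_specZeta, fockToL2_specZeta, inner_smul_left (E := FockL2 σ),
    ← HilbertBasis.repr_apply_apply, ← HilbertBasis.repr_apply_apply, map_mul, Complex.conj_I,
    Complex.conj_ofReal] at hm
  linear_combination hm

/-- **Adjoint, domain part.**  If `⟪(dΓ(X)F)~, u⟫ + ⟪F~, w⟫ = 0` for every polynomial `F`, then `u ∈ genDom hX`. -/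
theorem mem_genDom_of_forall_inner_core {X : Matrix σ σ ℂ} (hX : star X = -X) {u w : FockL2 σ}
    (h : ∀ F : MvPolynomial σ ℂ, ⟪fockToL2 (dGamma X F), u⟫_ℂ + ⟪fockToL2 F, w⟫_ℂ = 0) : u ∈ genDom hX := by
  have hfun : (fun m : σ →₀ ℕ => I * (wtPair m (specFreq hX) : ℂ) * (specBasis hX).repr u m)
      = ⇑((specBasis hX).repr w) := funext fun m => (specBasis_repr_eq_of_forall_inner_core hX h m).symm
  change Memℓp _ 2
  rw [hfun]
  exact lp.memℓp _

/-- **Adjoint, value part.**  … and then `genOp u = w`.  Together with `inner_dGamma_add_inner_genOp`: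
the adjoint of `dΓ(X)|_{core}` is exactly `−genOp hX` (domain `genDom hX`). -/
theorem genOp_eq_of_forall_inner_core {X : Matrix σ σ ℂ} (hX : star X = -X) {u w : FockL2 σ}
    (h : ∀ F : MvPolynomial σ ℂ, ⟪fockToL2 (dGamma X F), u⟫_ℂ + ⟪fockToL2 F, w⟫_ℂ = 0) :
    genOp hX ⟨u, mem_genDom_of_forall_inner_core hX h⟩ = w := by
  apply (specBasis hX).repr.injective
  refine lp.ext (funext fun m => ?_)
  rw [specBasis_repr_genOp, specBasis_repr_eq_of_forall_inner_core hX h m]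

/-- The adjoint characterisation as an `iff`. -/
theorem forall_inner_core_iff {X : Matrix σ σ ℂ} (hX : star X = -X) (u w : FockL2 σ) :
    (∀ F : MvPolynomial σ ℂ, ⟪fockToL2 (dGamma X F), u⟫_ℂ + ⟪fockToL2 F, w⟫_ℂ = 0)
      ↔ ∃ hu : u ∈ genDom hX, genOp hX ⟨u, hu⟩ = w :=
  ⟨fun h => ⟨mem_genDom_of_forall_inner_core hX h, genOp_eq_of_forall_inner_core hX h⟩,
    fun ⟨hu, hw⟩ F => by rw [← hw]; exact inner_dGamma_add_inner_genOp hX F ⟨u, hu⟩⟩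

/-- **`genOp` is skew-adjoint**: if `⟪genOp v, u⟫ + ⟪v, w⟫ = 0` for all `v ∈ genDom`, then `u ∈ genDom` (and
`genOp u = w`, next theorem) — the adjoint of `genOp` has the SAME domain and equals `−genOp`. -/
theorem mem_genDom_of_forall_inner_genDom {X : Matrix σ σ ℂ} (hX : star X = -X) {u w : FockL2 σ}
    (h : ∀ v : genDom hX, ⟪genOp hX v, u⟫_ℂ + ⟪(v : FockL2 σ), w⟫_ℂ = 0) : u ∈ genDom hX :=
  mem_genDom_of_forall_inner_core hX fun F => by
    have hF := h ⟨fockToL2 F, fockToL2_mem_genDom hX F⟩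
    rwa [genOp_fockToL2] at hF

/-- (Ported verbatim from the HodgeCMPerL package; no docstring in the source.) -/
theorem genOp_eq_of_forall_inner_genDom {X : Matrix σ σ ℂ} (hX : star X = -X) {u w : FockL2 σ}
    (h : ∀ v : genDom hX, ⟪genOp hX v, u⟫_ℂ + ⟪(v : FockL2 σ), w⟫_ℂ = 0) :
    genOp hX ⟨u, mem_genDom_of_forall_inner_genDom hX h⟩ = w :=
  genOp_eq_of_forall_inner_core hX fun F => by
    have hF := h ⟨fockToL2 F, fockToL2_mem_genDom hX F⟩
    rwa [genOp_fockToL2] at hF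

/-- **Maximality.**  `genOp` has no proper skew-symmetric extension: a skew-symmetric operator `B` on a submodule
`D ⊇ core` agreeing with `dΓ(X)` on the core necessarily has `D ≤ genDom` and `B = genOp|_D`. -/
theorem le_genDom_of_skewSymmetric_extension {X : Matrix σ σ ℂ} (hX : star X = -X) {D : Submodule ℂ (FockL2 σ)}
    (B : D →ₗ[ℂ] FockL2 σ) (hcore : ∀ F : MvPolynomial σ ℂ, ∃ hF : fockToL2 F ∈ D, B ⟨fockToL2 F, hF⟩ = fockToL2 (dGamma X F))
    (hskew : ∀ v w : D, ⟪B v, (w : FockL2 σ)⟫_ℂ + ⟪(v : FockL2 σ), B w⟫_ℂ = 0) (u : D) :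
    ∃ hu : (u : FockL2 σ) ∈ genDom hX, genOp hX ⟨u, hu⟩ = B u := by
  refine (forall_inner_core_iff hX (u : FockL2 σ) (B u)).mp fun F => ?_
  obtain ⟨hF, hBF⟩ := hcore F
  have h := hskew ⟨fockToL2 F, hF⟩ u
  rwa [hBF] at h

/-! ## §3  `genOp` is closed -/

/-- **Closed graph.**  If `v_n → x` in `𝓕_σ` with `v_n ∈ genDom` and `genOp v_n → y`, along any non-trivial filter,
then `x ∈ genDom hX` … -/
theorem mem_genDom_of_tendsto {X : Matrix σ σ ℂ} (hX : star X = -X) {ι : Type*} {l : Filter ι} [l.NeBot]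
    {v : ι → genDom hX} {x y : FockL2 σ} (hv : Tendsto (fun n => (v n : FockL2 σ)) l (𝓝 x))
    (hy : Tendsto (fun n => genOp hX (v n)) l (𝓝 y)) : x ∈ genDom hX := by
  refine mem_genDom_of_forall_inner_core hX (w := y) fun F => ?_
  have hlim : Tendsto (fun n => ⟪fockToL2 (dGamma X F), (v n : FockL2 σ)⟫_ℂ + ⟪fockToL2 F, genOp hX (v n)⟫_ℂ) l
      (𝓝 (⟪fockToL2 (dGamma X F), x⟫_ℂ + ⟪fockToL2 F, y⟫_ℂ)) :=
    ((continuous_const.inner continuous_id).continuousAt.tendsto.comp hv).add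
      ((continuous_const.inner continuous_id).continuousAt.tendsto.comp hy)
  have h0 : (fun n => ⟪fockToL2 (dGamma X F), (v n : FockL2 σ)⟫_ℂ + ⟪fockToL2 F, genOp hX (v n)⟫_ℂ) = fun _ => 0 :=
    funext fun n => inner_dGamma_add_inner_genOp hX F (v n)
  rw [h0] at hlim
  exact (tendsto_nhds_unique tendsto_const_nhds hlim).symm

/-- … and `genOp x = y`. -/
theorem genOp_eq_of_tendsto {X : Matrix σ σ ℂ} (hX : star X = -X) {ι : Type*} {l : Filter ι} [l.NeBot]
    {v : ι → genDom hX} {x y : FockL2 σ} (hv : Tendsto (fun n => (v n : FockL2 σ)) l (𝓝 x))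
    (hy : Tendsto (fun n => genOp hX (v n)) l (𝓝 y)) :
    genOp hX ⟨x, mem_genDom_of_tendsto hX hv hy⟩ = y := by
  refine genOp_eq_of_forall_inner_core hX fun F => ?_
  have hlim : Tendsto (fun n => ⟪fockToL2 (dGamma X F), (v n : FockL2 σ)⟫_ℂ + ⟪fockToL2 F, genOp hX (v n)⟫_ℂ) l
      (𝓝 (⟪fockToL2 (dGamma X F), x⟫_ℂ + ⟪fockToL2 F, y⟫_ℂ)) :=
    ((continuous_const.inner continuous_id).continuousAt.tendsto.comp hv).add
      ((continuous_const.inner continuous_id).continuousAt.tendsto.comp hy)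
  have h0 : (fun n => ⟪fockToL2 (dGamma X F), (v n : FockL2 σ)⟫_ℂ + ⟪fockToL2 F, genOp hX (v n)⟫_ℂ) = fun _ => 0 :=
    funext fun n => inner_dGamma_add_inner_genOp hX F (v n)
  rw [h0] at hlim
  exact (tendsto_nhds_unique tendsto_const_nhds hlim).symm

/-! ## §4  The polynomial core is a core for `genOp` -/

/-- The spectral truncation `F_s := Σ_{m ∈ s} v_m · specZeta m` of `v ∈ 𝓕_σ` — a core polynomial. -/
def specTrunc {X : Matrix σ σ ℂ} (hX : star X = -X) (v : FockL2 σ) (s : Finset (σ →₀ ℕ)) : MvPolynomial σ ℂ :=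
  ∑ m ∈ s, (specBasis hX).repr v m • specZeta hX m

/-- (Ported verbatim from the HodgeCMPerL package; no docstring in the source.) -/
theorem fockToL2_specTrunc {X : Matrix σ σ ℂ} (hX : star X = -X) (v : FockL2 σ) (s : Finset (σ →₀ ℕ)) :
    fockToL2 (specTrunc hX v s) = ∑ m ∈ s, (specBasis hX).repr v m • specBasis hX m := by
  rw [specTrunc, map_sum]
  exact Finset.sum_congr rfl fun m _ => by rw [map_smul, fockToL2_specZeta]

/-- (Ported verbatim from the HodgeCMPerL package; no docstring in the source.) -/
theorem fockToL2_dGamma_specTrunc {X : Matrix σ σ ℂ} (hX : star X = -X) (v : FockL2 σ) (s : Finset (σ →₀ ℕ)) :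
    fockToL2 (dGamma X (specTrunc hX v s))
      = ∑ m ∈ s, (I * (wtPair m (specFreq hX) : ℂ) * (specBasis hX).repr v m) • specBasis hX m := by
  rw [specTrunc, map_sum, map_sum]
  exact Finset.sum_congr rfl fun m _ => by rw [map_smul, map_smul, fockToL2_dGamma_specZeta, smul_smul, mul_comm]

/-- **Core, part 1**: the truncations converge to `v` (for every `v ∈ 𝓕_σ`). -/
theorem tendsto_fockToL2_specTrunc {X : Matrix σ σ ℂ} (hX : star X = -X) (v : FockL2 σ) :
    Tendsto (fun s => fockToL2 (specTrunc hX v s)) atTop (𝓝 v) := by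
  have h := (specBasis hX).hasSum_repr v
  rw [HasSum] at h
  exact h.congr fun s => (fockToL2_specTrunc hX v s).symm

/-- **Core, part 2**: for `v ∈ genDom`, `dΓ(X)` of the truncations converges to `genOp v`.  With part 1 and §3:
the graph of `genOp hX` is the closure of the graph of `dΓ(X)|_{core}`. -/
theorem tendsto_fockToL2_dGamma_specTrunc {X : Matrix σ σ ℂ} (hX : star X = -X) (v : genDom hX) :
    Tendsto (fun s => fockToL2 (dGamma X (specTrunc hX (v : FockL2 σ) s))) atTop (𝓝 (genOp hX v)) := by
  have h := (specBasis hX).hasSum_repr (genOp hX v)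
  rw [HasSum] at h
  refine h.congr fun s => ?_
  rw [fockToL2_dGamma_specTrunc]
  exact Finset.sum_congr rfl fun m _ => by rw [specBasis_repr_genOp]

/-- **Graph density, metric form**: every `v ∈ genDom` is approximated by core vectors in the graph norm. -/
theorem exists_core_graph_approx {X : Matrix σ σ ℂ} (hX : star X = -X) (v : genDom hX) {ε : ℝ} (hε : 0 < ε) :
    ∃ F : MvPolynomial σ ℂ, ‖fockToL2 F - (v : FockL2 σ)‖ < ε ∧ ‖fockToL2 (dGamma X F) - genOp hX v‖ < ε := by
  have h1 := (tendsto_iff_norm_sub_tendsto_zero.mp (tendsto_fockToL2_specTrunc hX (v : FockL2 σ))).eventually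
    (gt_mem_nhds hε)
  have h2 := (tendsto_iff_norm_sub_tendsto_zero.mp (tendsto_fockToL2_dGamma_specTrunc hX v)).eventually
    (gt_mem_nhds hε)
  obtain ⟨s, hs⟩ := (h1.and h2).exists
  exact ⟨specTrunc hX (v : FockL2 σ) s, hs.1, hs.2⟩

end HodgeCM.PerL34.Fock.Hermite

end
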